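import Summits.BirchSwinnertonDyer.BirchSwinnertonDyer.Theses.KatoDescentTamePotSupersingular
import Summits.BirchSwinnertonDyer.Rank1Residual.Additive.FouquetWanLocus
import Summits.BirchSwinnertonDyer.Rank1Residual.O6.X3WildOfKMCOfReadings
import Summits.BirchSwinnertonDyer.Rank1Residual.Additive.KMCTrivialDescentRankZero
import HarnessLib

/-!
# Route `KatoDescentTamePotSupersingular` (rung K8, sub-rung B4 (t′), cell `bsd-potss`): the crux
# `TameLowerHalfRankZero` (L₀, item stmt-BirchSwinnertonDyer-19981) ON THE FOUQUET–WAN LOCUS, and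
# its EQUIVALENCE WITH `KMC⁰` on the tower-surjective rows (a `--supports … --as helper` file)

The registered BC3 skeleton of the crux (planner g8, `Lines/birth.lean`) splits L₀ by the Fouquet–Wan
locus `ClassX4 W p ∧ LocIrr W p ∧ FWNonsplitRam W p` (`Additive/FouquetWanLocus.lean`): the stub
`stub_lower_fwLocus` (inside) and `stub_lower_offLocus` (outside), composed by excluded middle.

This file records, over DISPLAYED hypothesis schemata and nothing else:

* §1 **Inside the locus the torsion-free member is the curve itself.** `ClassX4 W p` says `E[p]` is
  irreducible, hence `p ∤ #E(ℚ)_tors` (tree `not_dvd_torsionOrder_of_irr`, part 9), so the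
  cell's image-free descent at a TORSION-FREE member (part 8b, `TorsionFree.missingPPartAt_rankZero_of_kmc`)
  applies to `W` directly — no isogeny walk, no Mazur–Kenku, no Cassels: **KMC_p at `W` ⇒ `MissingPPartAt
  W p`** (both halves) on every irreducible (t′) row of analytic rank `0`
  (`tameMissingPPartAt_rankZero_of_irr_of_kmc`).
* §2 **The FW-locus stub modulo the announced claim.** With `FouquetWanClaimShape KMC` (the SHAPE of
  arXiv:2107.13726 Thm. 5.1 / 1.7 for `f = f_E`; PRE, unrefereed, consumed ONLY as an explicit hypothesis)
  §1 gives the registered statement `Sig.stub_lower_fwLocus` VERBATIM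
  (`tameLowerHalf_fwLocus_of_fouquetWanClaim`), indeed the full `p`-part there, and reduces the crux BY
  NAME to its off-locus stub (`tameLowerHalfRankZero_of_offLocus_of_fouquetWanClaim`).
* §3 **Why L₀ is open — in kernel form.** On the rows with surjective `p`-adic tower (Kato's (12.5.2)),
  over the part-1/2 readings (`Additive.DescentCountReading`, `Additive.DivisibilityReading`,
  `Additive.Realizable`, `ReadsTrivialKMC`) + GZK + modularity, the tree's Proposition M
  (`kmc_iff_missingLowerBoundAt_of_readings`) makes the lower half EQUIVALENT to Kato's Conj. 12.10 on
  the trivial component: so **any proof of `TameLowerHalfRankZero` proves `KMC⁰` for every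
  tower-surjective (t′) curve of analytic rank `0`** (`kmc_of_tameLowerHalfRankZero_of_towerSurj`), and
  conversely the BC5 rung `Sig.stub_lower_three_e4_rung` (`p = 3`, `e = 4`, tower-surjective) is EXACTLY
  `KMC₃⁰` on its rows (`tameLowerHalf_three_e4_rung_of_kmc`, `kmc_of_tameLowerHalf_three_e4_rung`).

CONDITIONAL throughout (audit `proof.conditional`): every reading, the interface `KMC`, the claim shape
and the published facts GZK / modularity are displayed hypotheses; nothing about Kato's objects or the
Fouquet–Wan preprint is asserted; no Literature fact is minted; the item is NOT closed. Seat
`bsd-potss-k8t-c2` (prover-bsd-potss-k8t-c2-g0-0).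

References: [Kato2004Asterisque] Conj. 12.10 (p. 224), Thm. 12.5 (4) and (12.5.2) (p. 222), §14.14
(p. 243), Prop. 14.16 (2) (p. 244); [FouquetWan2021] = arXiv:2107.13726 Thm. 1.7 (p. 5), Thm. 5.1
(p. 53); [Mazur1977] Ch. III §5 (p. 157); [Miller2011LMS] Def. 1.1.
-/

set_option autoImplicit false
-- sibling precedent (`KatoDescentTamePotSupersingularAssembly.lean`): the directory name repeats the summit name
set_option linter.dupNamespace false

noncomputable section

open scoped Classical

namespace Summit.BirchSwinnertonDyer.BirchSwinnertonDyer.Theorems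

open WeierstrassCurve Literature.NumberTheory.EllipticCurves
  Literature.NumberTheory.EllipticCurves.Rank1Residual
  Literature.NumberTheory.EllipticCurves.Rank1Residual.Typed
  Summit.BirchSwinnertonDyer.Rank1Residual.Additive
  Summit.BirchSwinnertonDyer.Rank1Residual
  Summit.BirchSwinnertonDyer.BirchSwinnertonDyer.Theses.KatoDescentTamePotSupersingular

variable {IsOf : ∀ (W : WeierstrassCurve ℚ) [W.IsElliptic] [W.IsGloballyMinimal] (p : ℕ) [Fact p.Prime],
  KatoDescentDatum p → Prop}
variable {KMC : ∀ (W : WeierstrassCurve ℚ) [W.IsElliptic] [W.IsGloballyMinimal] (p : ℕ), Prop}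

/-! ## §1 Inside the locus the torsion-free member is the curve itself -/

/-- **KMC_p at the curve ITSELF ⇒ the `p`-part (both halves) on every IRREDUCIBLE (t′) row of analytic
rank `0`** — the cell's image-free descent at a torsion-free member (part 8b,
`TorsionFree.missingPPartAt_rankZero_of_kmc`, over Readings 1♭/3♭ and the interface lemma) applied to
`W`, which is its own torsion-free member because `E[p]` is irreducible (part 9's
`not_dvd_torsionOrder_of_irr`); `(t′) ⇒ ord_p j ≥ 0` by
`ClassO5.padicValRat_j_nonneg`. No isogeny walk, no Mazur–Kenku, no Cassels. Conditional over displayed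
readings. [cite: Kato2004Asterisque, Conj. 12.10 (p. 224), §14.14 (p. 243), Prop. 14.16 (2) (p. 244)] -/
theorem tameMissingPPartAt_rankZero_of_irr_of_kmc (hR : TorsionFree.DescentCountReading IsOf)
    (hreal : TorsionFree.RealizableOfKMC IsOf KMC) (hread : ReadsTrivialKMC IsOf KMC)
    (hGZK : rank_eq_analyticRank_of_analyticRank_le_one) (hmod : hasEntireLFunction_rat)
    (W : WeierstrassCurve ℚ) [W.IsElliptic] [W.IsGloballyMinimal] (p : ℕ) [Fact p.Prime]
    (hr : W.analyticRank = 0) (hp2 : p ≠ 2) (hadd : Addv W p) (hT : SubTprime W p) (hirr : Irr W p)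
    (hKMC : KMC W p) : MissingPPartAt W p :=
  have hO5 : ClassO5 W p := ⟨hp2, hadd, Or.inr hT⟩
  TorsionFree.missingPPartAt_rankZero_of_kmc W p hR hreal hread hGZK hmod hr hp2 hadd
    hO5.padicValRat_j_nonneg (not_dvd_torsionOrder_of_irr W p hirr) hKMC

/-- **… hence the LOWER half there** (the crux's currency). [cite: Kato2004Asterisque, Conj. 12.10 (p. 224)]
[cite: Miller2011LMS, Def. 1.1] -/
theorem tameMissingLowerBoundAt_rankZero_of_irr_of_kmc (hR : TorsionFree.DescentCountReading IsOf)
    (hreal : TorsionFree.RealizableOfKMC IsOf KMC) (hread : ReadsTrivialKMC IsOf KMC)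
    (hGZK : rank_eq_analyticRank_of_analyticRank_le_one) (hmod : hasEntireLFunction_rat)
    (W : WeierstrassCurve ℚ) [W.IsElliptic] [W.IsGloballyMinimal] (p : ℕ) [Fact p.Prime]
    (hr : W.analyticRank = 0) (hp2 : p ≠ 2) (hadd : Addv W p) (hT : SubTprime W p) (hirr : Irr W p)
    (hKMC : KMC W p) : MissingLowerBoundAt W p :=
  (lower_and_upper_of_missingPPartAt W p
    (tameMissingPPartAt_rankZero_of_irr_of_kmc hR hreal hread hGZK hmod W p hr hp2 hadd hT hirr hKMC)).1

/-! ## §2 The FW-locus stub modulo the announced claim (PRE; explicit hypothesis `hFW`) -/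

/-- **Inside the Fouquet–Wan locus, rank `0`: the `p`-part in Miller's currency from the announced
claim** — `FouquetWanClaimShape KMC` (arXiv:2107.13726 Thm. 5.1 / 1.7 for `f = f_E`: `E[p]` irreducible,
`E[p]|G_{ℚ_p}` irreducible, a non-split multiplicative `q ≠ p` with `E[p]` ramified ⊢ `KMC W p`; PRE,
consumed only as the explicit hypothesis `hFW`) + §1. Nothing credited.
[cite: FouquetWan2021, Thm. 5.1 (p. 53) and Thm. 1.7 (p. 5)] [cite: Kato2004Asterisque, Conj. 12.10 (p. 224)] -/
theorem tameMissingPPartAt_rankZero_fwLocus_of_fouquetWanClaim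
    (hR : TorsionFree.DescentCountReading IsOf) (hreal : TorsionFree.RealizableOfKMC IsOf KMC)
    (hread : ReadsTrivialKMC IsOf KMC) (hGZK : rank_eq_analyticRank_of_analyticRank_le_one)
    (hmod : hasEntireLFunction_rat) (hFW : FouquetWanClaimShape KMC)
    (W : WeierstrassCurve ℚ) [W.IsElliptic] [W.IsGloballyMinimal] (p : ℕ) [Fact p.Prime]
    (hr : W.analyticRank = 0) (hp2 : p ≠ 2) (hadd : Addv W p) (hT : SubTprime W p)
    (hloc : ClassX4 W p ∧ LocIrr W p ∧ FWNonsplitRam W p) : MissingPPartAt W p :=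
  tameMissingPPartAt_rankZero_of_irr_of_kmc hR hreal hread hGZK hmod W p hr hp2 hadd hT hloc.1.2.2
    (hFW W p hloc.1 hloc.2.1 hloc.2.2)

/-- **The registered stub `stub_lower_fwLocus` (its statement `Sig.stub_lower_fwLocus` VERBATIM) OVER
the Fouquet–Wan claim shape and the torsion-free readings**: the rank-`0` lower half `ord_p #Ш_an ≤
ord_p #Ш` on the (t′) rows inside the locus. CONDITIONAL (FW is an unrefereed preprint; the readings
and `KMC` are interfaces) — the stub is NOT landed by name, this is its two-layer parent in the kernel.
[cite: FouquetWan2021, Thm. 5.1 (p. 53) and Thm. 1.7 (p. 5)] [cite: Kato2004Asterisque, Conj. 12.10 (p. 224), Prop. 14.16 (2) (p. 244)] -/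
theorem tameLowerHalf_fwLocus_of_fouquetWanClaim (hR : TorsionFree.DescentCountReading IsOf)
    (hreal : TorsionFree.RealizableOfKMC IsOf KMC) (hread : ReadsTrivialKMC IsOf KMC)
    (hGZK : rank_eq_analyticRank_of_analyticRank_le_one) (hmod : hasEntireLFunction_rat)
    (hFW : FouquetWanClaimShape KMC) :
    ∀ (W : WeierstrassCurve ℚ) [W.IsElliptic] [W.IsGloballyMinimal] (p : ℕ) [Fact p.Prime],
      W.analyticRank = 0 → p ≠ 2 → Addv W p → SubTprime W p →
      (ClassX4 W p ∧ LocIrr W p ∧ FWNonsplitRam W p) → MissingLowerBoundAt W p :=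
  fun W _ _ p _ hr hp2 hadd hT hloc ↦ tameMissingLowerBoundAt_rankZero_of_irr_of_kmc hR hreal hread hGZK
    hmod W p hr hp2 hadd hT hloc.1.2.2 (hFW W p hloc.1 hloc.2.1 hloc.2.2)

/-- **The crux BY NAME, reduced to its off-locus stub**: granted the registered statement
`Sig.stub_lower_offLocus` (verbatim, as the hypothesis `hoff` — the genuinely open residue:
canonical-subgroup rows, rows without a non-split Steinberg prime at which `E[p]` ramifies, reducible
rows), the Fouquet–Wan claim shape and the torsion-free readings give
`TameLowerHalfRankZero` (excluded middle on the locus, as in the skeleton's `_of`). Conditional; the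
item is NOT closed. [cite: FouquetWan2021, Thm. 5.1 (p. 53)] [cite: Kato2004Asterisque, Conj. 12.10 (p. 224)] -/
theorem tameLowerHalfRankZero_of_offLocus_of_fouquetWanClaim
    (hR : TorsionFree.DescentCountReading IsOf) (hreal : TorsionFree.RealizableOfKMC IsOf KMC)
    (hread : ReadsTrivialKMC IsOf KMC) (hGZK : rank_eq_analyticRank_of_analyticRank_le_one)
    (hmod : hasEntireLFunction_rat) (hFW : FouquetWanClaimShape KMC)
    (hoff : ∀ (W : WeierstrassCurve ℚ) [W.IsElliptic] [W.IsGloballyMinimal] (p : ℕ) [Fact p.Prime],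
      W.analyticRank = 0 → p ≠ 2 → Addv W p → SubTprime W p →
      ¬ (ClassX4 W p ∧ LocIrr W p ∧ FWNonsplitRam W p) → MissingLowerBoundAt W p) :
    Summit.BirchSwinnertonDyer.BirchSwinnertonDyer.Theses.KatoDescentTamePotSupersingular.TameLowerHalfRankZero := by
  intro W _ _ p _ hr hp2 hadd hT
  by_cases hloc : (ClassX4 W p ∧ LocIrr W p ∧ FWNonsplitRam W p)
  · exact tameLowerHalf_fwLocus_of_fouquetWanClaim hR hreal hread hGZK hmod hFW W p hr hp2 hadd hT hloc
  · exact hoff W p hr hp2 hadd hT hloc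

/-! ## §3 Why L₀ is open, in kernel form: on the tower-surjective rows it IS `KMC⁰` (over the part-1/2 readings) -/

/-- **L₀ PROVES `KMC⁰` on the (12.5.2) rows.** Granted the crux `TameLowerHalfRankZero`, Kato's Main
Conjecture 12.10 on the trivial component holds for EVERY (t′) curve of analytic rank `0` with surjective
`p`-adic tower — over part 1's Readings 1–3 (`Additive.DescentCountReading`, `Additive.DivisibilityReading`
= Thm. 12.5 (4) under (12.5.2), `Additive.Realizable`), the interface lemma, GZK and modularity, by the
tree's Proposition M (`kmc_of_missingLowerBoundAt_of_readings`). So the crux is at least as strong as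
Kato's IMC (trivial component) on those rows: this is the typed form of its «difficulty: open-problem».
[cite: Kato2004Asterisque, Conj. 12.10 (p. 224), Thm. 12.5 (4) (p. 222), §14.14 (p. 243), Prop. 14.16 (2) (p. 244)] -/
theorem kmc_of_tameLowerHalfRankZero_of_towerSurj (hR : Additive.DescentCountReading IsOf)
    (hdiv : Additive.DivisibilityReading IsOf) (hreal : Additive.Realizable IsOf)
    (hread : ReadsTrivialKMC IsOf KMC) (hGZK : rank_eq_analyticRank_of_analyticRank_le_one)
    (hmod : hasEntireLFunction_rat)
    (hL₀ : Summit.BirchSwinnertonDyer.BirchSwinnertonDyer.Theses.KatoDescentTamePotSupersingular.TameLowerHalfRankZero)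
    (W : WeierstrassCurve ℚ) [W.IsElliptic] [W.IsGloballyMinimal] (p : ℕ) [Fact p.Prime]
    (hr : W.analyticRank = 0) (hp2 : p ≠ 2) (hadd : Addv W p) (hT : SubTprime W p)
    (hsurj : ∀ n : ℕ, W.HasSurjectiveModNGaloisRep (p ^ n : ℕ)) : KMC W p :=
  have hO5 : ClassO5 W p := ⟨hp2, hadd, Or.inr hT⟩
  have hK : Kato2004.ImageContainsSL2 W p :=
    (Kato2004.imageContainsSL2_iff_forall_hasSurjectiveModNGaloisRep W p).mpr hsurj
  kmc_of_missingLowerBoundAt_of_readings hR hdiv hreal hread hGZK hmod W p hr hp2 hadd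
    hO5.padicValRat_j_nonneg hK (hL₀ W p hr hp2 hadd hT)

/-- **The BC5 rung OVER `KMC₃⁰`** (its statement `Sig.stub_lower_three_e4_rung` VERBATIM as the
conclusion): at `p = 3` on the (t′) rows (`e = 4`, Kodaira III/III*) of analytic rank `0` with surjective
`3`-adic tower, `KMC W 3 ⇒ ord₃ #Ш_an ≤ ord₃ #Ш` — part 2's uniform shell
`missingLowerBoundAt_potGood_of_kmc_of_readings` over part 1's Readings 1/3 and the interface lemma.
Conditional; the rung stub is NOT landed by name. [cite: Kato2004Asterisque, Conj. 12.10 (p. 224), §14.14 (p. 243), Prop. 14.16 (2) (p. 244)] -/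
theorem tameLowerHalf_three_e4_rung_of_kmc (hR : Additive.DescentCountReading IsOf)
    (hreal : Additive.Realizable IsOf) (hread : ReadsTrivialKMC IsOf KMC)
    (hGZK : rank_eq_analyticRank_of_analyticRank_le_one) (hmod : hasEntireLFunction_rat)
    (hK : ∀ (W : WeierstrassCurve ℚ) [W.IsElliptic] [W.IsGloballyMinimal] [Fact (3 : ℕ).Prime],
      W.analyticRank = 0 → Addv W 3 → SubTprime W 3 →
      (∀ n : ℕ, W.HasSurjectiveModNGaloisRep (3 ^ n : ℕ)) → KMC W 3) :
    ∀ (W : WeierstrassCurve ℚ) [W.IsElliptic] [W.IsGloballyMinimal] [Fact (3 : ℕ).Prime],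
      W.analyticRank = 0 → Addv W 3 → SubTprime W 3 →
      (∀ n : ℕ, W.HasSurjectiveModNGaloisRep (3 ^ n : ℕ)) → MissingLowerBoundAt W 3 := by
  intro W _ _ _ hr hadd hT hsurj
  have hO5 : ClassO5 W 3 := ⟨by decide, hadd, Or.inr hT⟩
  have hK' : Kato2004.ImageContainsSL2 W 3 :=
    (Kato2004.imageContainsSL2_iff_forall_hasSurjectiveModNGaloisRep W 3).mpr hsurj
  exact missingLowerBoundAt_potGood_of_kmc_of_readings hR hreal hread hGZK hmod W 3 hr (by decide) hadd
    hO5.padicValRat_j_nonneg hK' (hK W hr hadd hT hsurj)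

/-- **… and conversely the rung PROVES `KMC₃⁰` on its rows** (over Readings 1–3 + the interface lemma +
GZK + modularity): the BC5 rung is EXACTLY Kato's Conj. 12.10 (trivial component) for the
tower-surjective (t′) curves of analytic rank `0` at `p = 3`. [cite: Kato2004Asterisque, Conj. 12.10 (p. 224), Thm. 12.5 (4) (p. 222), §14.14 (p. 243)] -/
theorem kmc_of_tameLowerHalf_three_e4_rung (hR : Additive.DescentCountReading IsOf)
    (hdiv : Additive.DivisibilityReading IsOf) (hreal : Additive.Realizable IsOf)
    (hread : ReadsTrivialKMC IsOf KMC) (hGZK : rank_eq_analyticRank_of_analyticRank_le_one)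
    (hmod : hasEntireLFunction_rat)
    (hrung : ∀ (W : WeierstrassCurve ℚ) [W.IsElliptic] [W.IsGloballyMinimal] [Fact (3 : ℕ).Prime],
      W.analyticRank = 0 → Addv W 3 → SubTprime W 3 →
      (∀ n : ℕ, W.HasSurjectiveModNGaloisRep (3 ^ n : ℕ)) → MissingLowerBoundAt W 3)
    (W : WeierstrassCurve ℚ) [W.IsElliptic] [W.IsGloballyMinimal] [Fact (3 : ℕ).Prime]
    (hr : W.analyticRank = 0) (hadd : Addv W 3) (hT : SubTprime W 3)
    (hsurj : ∀ n : ℕ, W.HasSurjectiveModNGaloisRep (3 ^ n : ℕ)) : KMC W 3 :=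
  have hO5 : ClassO5 W 3 := ⟨by decide, hadd, Or.inr hT⟩
  have hK : Kato2004.ImageContainsSL2 W 3 :=
    (Kato2004.imageContainsSL2_iff_forall_hasSurjectiveModNGaloisRep W 3).mpr hsurj
  kmc_of_missingLowerBoundAt_of_readings hR hdiv hreal hread hGZK hmod W 3 hr (by decide) hadd
    hO5.padicValRat_j_nonneg hK (hrung W hr hadd hT hsurj)

end Summit.BirchSwinnertonDyer.BirchSwinnertonDyer.Theorems

end
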